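import Summits.AtomisticToContinuum.BoseEinsteinCondensation.Theorems.BoxCountShadowDecoupling
import HarnessLib

/-!
# BoxCountShadowHarnack — continuation of BoxCountShadowDecoupling: Harnack-type inputs (§9)

Continuation of `BoxCountShadowDecoupling` (same namespace).  Tonelli reverse Cauchy–Schwarz under a
cross-ratio bound (`lintegral_mul_lintegral_le_of_cross`, set version, `setLIntegral_rpow_half_mul_ge_of_cross`);
the WARNING piece `GroundStateHorizonBlockEquidistribution` (BEQ_h, uniform one-coordinate block Harnack) with
`horizonLabelAffinity_of_blockEquidistribution : BEQ_h → LAB_h` (target-strength, hence not a door) and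
`bec_of_blockEquidistribution₀`; the door `GroundStateHorizonFibreHarnack` (FH_h, cross-fibre comparability of
the block propensity; Mott-compatible) with `horizonCountDecoupling_of_fibreHarnack : FH_h → DEC_h` and
`bec_of_fibreHarnack₀`.
No instances, no notation, no sorry.
-/

open MeasureTheory Filter Set
open scoped ENNReal NNReal BigOperators

namespace Summit.AtomisticToContinuum.BoseEinsteinCondensation.Theorems.BoxCountShadow

open Literature.MathematicalPhysics.QuantumManyBody.BoseGas
open Summit.AtomisticToContinuum.BoseEinsteinCondensation.Theorems.BoxLatticeFSum
open Summit.AtomisticToContinuum.BoseEinsteinCondensation.Theorems.BoxLabelAffinity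
open Summit.AtomisticToContinuum.BoseEinsteinCondensation.Theorems.BoxHorizonAffinity

variable {n : ℕ}

/-! ### §9  Harnack-type inputs (critic row 484 order (3), executed with a correction)

Two positivity inputs and what each buys.  (i) The UNIFORM one-coordinate block Harnack «`q_B(Y) ≥ κ·K⁻³·P̂(Y)`
for every block `B` and typical `Y`» (BEQ_h, block equidistribution of the tagged particle given the others) is
NOT a door for a piece: it gives the WHOLE target LAB_h(η) directly with `c = κ^{1/2}/2`
(`horizonLabelAffinity_of_blockEquidistribution`, PROVED) — so «DEC_h ⟸ H1» with H1 uniform in `B` would be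
true but would hide that H1 is target-strength.  (ii) The input DEC_h actually needs is CROSS-FIBRE
comparability: on typical `(m,B)`, the block propensity `q_B/P̂` varies by at most a factor `C` between two
configurations of the others with the SAME count field (FH_h, fibre Harnack; holds with `C = 1` in the
number-locked model, where NUM_h fails — so FH_h ⇏ NUM_h).  FH_h ⟹ DEC_h with `s₀ = C^{-1/4}` by a Tonelli /
reverse-Cauchy–Schwarz lemma (`setLIntegral_mul_setLIntegral_le_of_cross`, PROVED; 0 EQUIV). -/

section Cross

variable {β : Type*} [MeasurableSpace β]

/-- **Reverse Cauchy–Schwarz under a cross-ratio bound** (Tonelli): if `g(b) f(b') ≤ C g(b') f(b)` for all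
`b, b'`, then `(∫f)(∫g) ≤ C^{1/2} (∫ f^{1/2} g^{1/2})²`. [folklore] -/
theorem lintegral_mul_lintegral_le_of_cross (ν : Measure β) [SFinite ν] {f g : β → ℝ≥0∞} (hf : Measurable f)
    (hg : Measurable g) (C : ℝ≥0∞) (h : ∀ b b', g b * f b' ≤ C * (g b' * f b)) :
    (∫⁻ b, f b ∂ν) * (∫⁻ b, g b ∂ν) ≤
      C ^ (1 / 2 : ℝ) * (∫⁻ b, f b ^ (1 / 2 : ℝ) * g b ^ (1 / 2 : ℝ) ∂ν) ^ 2 := by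
  have rpow_half_sq : ∀ m : ℝ≥0∞, (m ^ 2) ^ (1 / 2 : ℝ) = m := fun m => by
    rw [← ENNReal.rpow_two, ← ENNReal.rpow_mul]; norm_num
  set u : β → ℝ≥0∞ := fun b => f b ^ (1 / 2 : ℝ) * g b ^ (1 / 2 : ℝ) with hudef
  have hu : Measurable u := (hf.pow_const _).mul (hg.pow_const _)
  have hpt : ∀ b b', f b * g b' ≤ C ^ (1 / 2 : ℝ) * (u b * u b') := by
    intro b b'
    have hsq : (f b * g b') ^ 2 ≤ C * ((f b * g b) * (f b' * g b')) :=
      calc (f b * g b') ^ 2 = (f b * g b') * (g b' * f b) := by ring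
        _ ≤ (f b * g b') * (C * (g b * f b')) := mul_le_mul' le_rfl (h b' b)
        _ = C * ((f b * g b) * (f b' * g b')) := by ring
    have hle := ENNReal.rpow_le_rpow hsq (show (0 : ℝ) ≤ 1 / 2 by norm_num)
    rw [rpow_half_sq, ENNReal.mul_rpow_of_nonneg _ _ (by norm_num),
      ENNReal.mul_rpow_of_nonneg _ _ (by norm_num), ENNReal.mul_rpow_of_nonneg _ _ (by norm_num),
      ENNReal.mul_rpow_of_nonneg _ _ (by norm_num)] at hle
    exact hle
  rw [← lintegral_prod_mul hf.aemeasurable hg.aemeasurable]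
  calc ∫⁻ p, f p.1 * g p.2 ∂ν.prod ν ≤ ∫⁻ p, C ^ (1 / 2 : ℝ) * (u p.1 * u p.2) ∂ν.prod ν :=
        lintegral_mono fun p => hpt p.1 p.2
    _ = C ^ (1 / 2 : ℝ) * ∫⁻ p, u p.1 * u p.2 ∂ν.prod ν :=
        lintegral_const_mul _ ((hu.comp measurable_fst).mul (hu.comp measurable_snd))
    _ = C ^ (1 / 2 : ℝ) * (∫⁻ b, u b ∂ν) ^ 2 := by
        rw [lintegral_prod_mul hu.aemeasurable hu.aemeasurable, sq]

/-- The set version of `lintegral_mul_lintegral_le_of_cross` (cross-ratio bound on `s` only). [folklore] -/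
theorem setLIntegral_mul_setLIntegral_le_of_cross (ν : Measure β) [SFinite ν] {s : Set β} (hs : MeasurableSet s)
    {f g : β → ℝ≥0∞} (hf : Measurable f) (hg : Measurable g) (C : ℝ≥0∞)
    (h : ∀ b ∈ s, ∀ b' ∈ s, g b * f b' ≤ C * (g b' * f b)) :
    (∫⁻ b in s, f b ∂ν) * (∫⁻ b in s, g b ∂ν) ≤
      C ^ (1 / 2 : ℝ) * (∫⁻ b in s, f b ^ (1 / 2 : ℝ) * g b ^ (1 / 2 : ℝ) ∂ν) ^ 2 := by
  have key := lintegral_mul_lintegral_le_of_cross ν (hf.indicator hs) (hg.indicator hs) C (by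
    intro b b'
    by_cases hb : b ∈ s
    · by_cases hb' : b' ∈ s
      · rw [Set.indicator_of_mem hb, Set.indicator_of_mem hb, Set.indicator_of_mem hb',
          Set.indicator_of_mem hb']
        exact h b hb b' hb'
      · rw [Set.indicator_of_notMem hb' f, mul_zero]
        exact bot_le
    · rw [Set.indicator_of_notMem hb g, zero_mul]
      exact bot_le)
  have hprod : ∀ b, (s.indicator f b) ^ (1 / 2 : ℝ) * (s.indicator g b) ^ (1 / 2 : ℝ) =
      s.indicator (fun b => f b ^ (1 / 2 : ℝ) * g b ^ (1 / 2 : ℝ)) b := by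
    intro b
    by_cases hb : b ∈ s
    · rw [Set.indicator_of_mem hb, Set.indicator_of_mem hb, Set.indicator_of_mem hb]
    · rw [Set.indicator_of_notMem hb, Set.indicator_of_notMem hb, Set.indicator_of_notMem hb,
        ENNReal.zero_rpow_of_pos (by norm_num), zero_mul]
  simp_rw [hprod, lintegral_indicator hs] at key
  exact key

/-- **Reverse Cauchy–Schwarz**: under the cross-ratio bound on `s` with `0 < C < ∞`,
`C^{-1/4} (∫_s f)^{1/2} (∫_s g)^{1/2} ≤ ∫_s f^{1/2} g^{1/2}`. [folklore] -/
theorem setLIntegral_rpow_half_mul_ge_of_cross (ν : Measure β) [SFinite ν] {s : Set β} (hs : MeasurableSet s)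
    {f g : β → ℝ≥0∞} (hf : Measurable f) (hg : Measurable g) {C : ℝ≥0∞} (hC0 : C ≠ 0) (hCt : C ≠ ∞)
    (h : ∀ b ∈ s, ∀ b' ∈ s, g b * f b' ≤ C * (g b' * f b)) :
    (C ^ (1 / 4 : ℝ))⁻¹ * ((∫⁻ b in s, f b ∂ν) ^ (1 / 2 : ℝ) * (∫⁻ b in s, g b ∂ν) ^ (1 / 2 : ℝ)) ≤
      ∫⁻ b in s, f b ^ (1 / 2 : ℝ) * g b ^ (1 / 2 : ℝ) ∂ν := by
  have rpow_half_sq : ∀ m : ℝ≥0∞, (m ^ 2) ^ (1 / 2 : ℝ) = m := fun m => by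
    rw [← ENNReal.rpow_two, ← ENNReal.rpow_mul]; norm_num
  have key := setLIntegral_mul_setLIntegral_le_of_cross ν hs hf hg C h
  have hle := ENNReal.rpow_le_rpow key (show (0 : ℝ) ≤ 1 / 2 by norm_num)
  rw [ENNReal.mul_rpow_of_nonneg _ _ (by norm_num), ENNReal.mul_rpow_of_nonneg _ _ (by norm_num),
    rpow_half_sq, ← ENNReal.rpow_mul, show (1 / 2 * (1 / 2 : ℝ)) = 1 / 4 by norm_num] at hle
  have hc0 : C ^ (1 / 4 : ℝ) ≠ 0 := (ENNReal.rpow_pos_of_nonneg (pos_iff_ne_zero.2 hC0) (by norm_num)).ne'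
  have hct : C ^ (1 / 4 : ℝ) ≠ ∞ := ENNReal.rpow_ne_top_of_nonneg (by norm_num) hCt
  calc (C ^ (1 / 4 : ℝ))⁻¹ * ((∫⁻ b in s, f b ∂ν) ^ (1 / 2 : ℝ) * (∫⁻ b in s, g b ∂ν) ^ (1 / 2 : ℝ))
      ≤ (C ^ (1 / 4 : ℝ))⁻¹ * (C ^ (1 / 4 : ℝ) * ∫⁻ b in s, f b ^ (1 / 2 : ℝ) * g b ^ (1 / 2 : ℝ) ∂ν) :=
        mul_le_mul' le_rfl hle
    _ = ∫⁻ b in s, f b ^ (1 / 2 : ℝ) * g b ^ (1 / 2 : ℝ) ∂ν := by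
        rw [← mul_assoc, ENNReal.inv_mul_cancel hc0 hct, one_mul]

end Cross

/-- **BEQ_h(η)** (TAG STRONGER than the target LAB_h(η) — `horizonLabelAffinity_of_blockEquidistribution`,
PROVED — hence NOT a door for a piece; recorded as the formal WARNING for the «one-coordinate block Harnack»
order) `GroundStateHorizonBlockEquidistribution η`: outside an exceptional set `E` of others-configurations of
`P̂`-mass `≤ 1/2`, EVERY horizon block receives the tagged particle at rate `≥ κ ×` fair share:
`q_B(Y) ≥ κ · K⁻³ · P̂(Y)` for all `B` (a Harnack inequality for `x ↦ Ψ₀(x,Y)²` across blocks, uniform in `B`).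
Why it might fail / why it is too strong: it is a POINTWISE-in-`Y` form of non-localisation of the tagged
particle and closes the box route by itself; fails in the number-locked and parity-locked models (as LAB_h does).
[cite: LSSY2005, Thm 7.1; AizenmanSimon1982 (Harnack for Schrödinger semigroups), DOI 10.1002/cpa.3160350206] -/
@[conjecture] def GroundStateHorizonBlockEquidistribution (η : ℝ≥0) : Prop :=
  ∀ v : ℝ → ℝ≥0∞, IsRepulsiveFiniteRange v → 0 < scatteringLength v →
    ∃ M₀ : ℝ, 0 < M₀ ∧ ∀ M : ℝ, M₀ ≤ M → ∃ κ : ℝ, 0 < κ ∧ ∃ ρ₀ : ℝ, 0 < ρ₀ ∧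
      ∀ ρ : ℝ, 0 < ρ → ρ < ρ₀ → ∀ᶠ n : ℕ in atTop,
        (∃ Ψ₀ : Config (n + 1) → ℝ, (∀ X, 0 ≤ Ψ₀ X) ∧
          IsGroundState v (sideLength ρ (n + 1)) (fun X => (Ψ₀ X : ℂ))) →
        ∀ K : ℕ, 0 < K → InWindow (M * ρ ^ (-(η : ℝ))) ρ (sideLength ρ (n + 1)) K →
          ∃ E : Set (Config n), MeasurableSet E ∧
            2 * ∫⁻ Y in E, sliceSq (groundState v (n + 1) (sideLength ρ (n + 1))) Y ≤ 1 ∧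
              ∀ Y : Config n, Y ∉ E → ∀ B : SubIdx K,
                ENNReal.ofReal κ *
                    (blockWeight K ^ 2 * sliceSq (groundState v (n + 1) (sideLength ρ (n + 1))) Y) ≤
                  blockMass (sideLength ρ (n + 1)) K (groundState v (n + 1) (sideLength ρ (n + 1))) B Y

/-- **Functional kernel of the warning**: block equidistribution outside a set of `P̂`-mass `≤ 1/2` gives
`labelAffinity ≥ κ^{1/2}/2`. [folklore] -/
theorem labelAffinity_ge_of_blockEquidistribution {L : ℝ} {K : ℕ} (hK : 0 < K) {Φ : Config (n + 1) → ℝ}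
    (hΦm : Measurable Φ) (hΦ1 : ∫⁻ Y : Config n, ∫⁻ x, ENNReal.ofReal (Φ (Matrix.vecCons x Y)) ^ 2 = 1)
    (κ : ℝ≥0∞) {E : Set (Config n)} (hE : MeasurableSet E) (hEm : 2 * ∫⁻ Y in E, sliceSq Φ Y ≤ 1)
    (h : ∀ Y : Config n, Y ∉ E → ∀ B : SubIdx K, κ * (blockWeight K ^ 2 * sliceSq Φ Y) ≤ blockMass L K Φ B Y) :
    κ ^ (1 / 2 : ℝ) / 2 ≤ labelAffinity L K Φ := by
  have sq_rpow_half : ∀ m : ℝ≥0∞, (m ^ (1 / 2 : ℝ)) ^ 2 = m := fun m => by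
    rw [← ENNReal.rpow_two, ← ENNReal.rpow_mul]; norm_num
  have rpow_half_sq : ∀ m : ℝ≥0∞, (m ^ 2) ^ (1 / 2 : ℝ) = m := fun m => by
    rw [← ENNReal.rpow_two, ← ENNReal.rpow_mul]; norm_num
  have hΦ1' : ∫⁻ Y : Config n, sliceSq Φ Y = 1 := hΦ1
  -- mass of the good set
  have htot : (∫⁻ Y in E, sliceSq Φ Y) + ∫⁻ Y in Eᶜ, sliceSq Φ Y = 1 := by
    rw [lintegral_add_compl _ hE, hΦ1']
  have hgood : (2 : ℝ≥0∞)⁻¹ ≤ ∫⁻ Y in Eᶜ, sliceSq Φ Y := by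
    have h2 : (1 : ℝ≥0∞) + 1 ≤ 1 + 2 * ∫⁻ Y in Eᶜ, sliceSq Φ Y :=
      calc (1 : ℝ≥0∞) + 1 = 2 * ((∫⁻ Y in E, sliceSq Φ Y) + ∫⁻ Y in Eᶜ, sliceSq Φ Y) := by
            rw [htot, mul_one]; norm_num
        _ = 2 * (∫⁻ Y in E, sliceSq Φ Y) + 2 * ∫⁻ Y in Eᶜ, sliceSq Φ Y := mul_add _ _ _
        _ ≤ 1 + 2 * ∫⁻ Y in Eᶜ, sliceSq Φ Y := add_le_add hEm le_rfl
    have h1 : (1 : ℝ≥0∞) ≤ 2 * ∫⁻ Y in Eᶜ, sliceSq Φ Y := (ENNReal.add_le_add_iff_left ENNReal.one_ne_top).1 h2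
    rw [← one_div]
    exact ENNReal.div_le_of_le_mul (by rwa [mul_comm] at h1)
  -- pointwise on the good set
  have hpt : ∀ Y : Config n, Y ∉ E →
      κ ^ (1 / 2 : ℝ) * sliceSq Φ Y ≤
        sliceSq Φ Y ^ (1 / 2 : ℝ) * ∑ B : SubIdx K, blockWeight K * blockMass L K Φ B Y ^ (1 / 2 : ℝ) := by
    intro Y hY
    set a := sliceSq Φ Y ^ (1 / 2 : ℝ) with hadef
    have ha : sliceSq Φ Y = a * a := by rw [← sq, hadef, sq_rpow_half]
    have hB : ∀ B : SubIdx K, blockWeight K * (κ ^ (1 / 2 : ℝ) * (blockWeight K * a)) ≤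
        blockWeight K * blockMass L K Φ B Y ^ (1 / 2 : ℝ) := by
      intro B
      have hle := ENNReal.rpow_le_rpow (h Y hY B) (show (0 : ℝ) ≤ 1 / 2 by norm_num)
      rw [ENNReal.mul_rpow_of_nonneg _ _ (by norm_num), ENNReal.mul_rpow_of_nonneg _ _ (by norm_num),
        rpow_half_sq] at hle
      exact mul_le_mul' le_rfl hle
    calc κ ^ (1 / 2 : ℝ) * sliceSq Φ Y
        = a * ((∑ B : SubIdx K, blockWeight K ^ 2) * (κ ^ (1 / 2 : ℝ) * a)) := by
          rw [sum_blockWeight_sq hK, one_mul, ha]; ring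
      _ = a * ∑ B : SubIdx K, blockWeight K * (κ ^ (1 / 2 : ℝ) * (blockWeight K * a)) := by
          rw [Finset.sum_mul]
          congr 1
          exact Finset.sum_congr rfl fun B _ => by ring
      _ ≤ a * ∑ B : SubIdx K, blockWeight K * blockMass L K Φ B Y ^ (1 / 2 : ℝ) :=
          mul_le_mul' le_rfl (Finset.sum_le_sum fun B _ => hB B)
  calc κ ^ (1 / 2 : ℝ) / 2 = κ ^ (1 / 2 : ℝ) * 2⁻¹ := div_eq_mul_inv _ _
    _ ≤ κ ^ (1 / 2 : ℝ) * ∫⁻ Y in Eᶜ, sliceSq Φ Y := mul_le_mul' le_rfl hgood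
    _ = ∫⁻ Y in Eᶜ, κ ^ (1 / 2 : ℝ) * sliceSq Φ Y := (lintegral_const_mul _ (measurable_sliceSq hΦm)).symm
    _ ≤ ∫⁻ Y in Eᶜ, sliceSq Φ Y ^ (1 / 2 : ℝ) *
          ∑ B : SubIdx K, blockWeight K * blockMass L K Φ B Y ^ (1 / 2 : ℝ) :=
        setLIntegral_mono' hE.compl fun Y hY => hpt Y hY
    _ ≤ labelAffinity L K Φ := setLIntegral_le_lintegral _ _

/-- **BEQ_h ⟹ LAB_h** directly (`c = κ^{1/2}/2`): the uniform block Harnack is TARGET-STRENGTH. [folklore] -/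
theorem horizonLabelAffinity_of_blockEquidistribution (η : ℝ≥0)
    (hbeq : GroundStateHorizonBlockEquidistribution η) : GroundStateHorizonLabelAffinity η := by
  intro v hv ha
  obtain ⟨M₀, hM₀, h⟩ := hbeq v hv ha
  obtain ⟨κ, hκ, ρ₀, hρ₀, h'⟩ := h M₀ le_rfl
  refine ⟨κ ^ (1 / 2 : ℝ) / 2, by positivity, M₀, hM₀, ρ₀, hρ₀, fun ρ hρ hρlt => ?_⟩
  filter_upwards [h' ρ hρ hρlt] with n hn hex K hK hKw
  set L := sideLength ρ (n + 1) with hLdef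
  set Φ := groundState v (n + 1) L with hΦdef
  have hΦm : Measurable Φ := measurable_groundState v (n + 1) L
  have hΦ1 : ∫⁻ Y : Config n, ∫⁻ x, ENNReal.ofReal (Φ (Matrix.vecCons x Y)) ^ 2 = 1 := by
    rw [← lintegral_eq_lintegral_lintegral_vecCons (hΦm.ennreal_ofReal.pow_const 2)]
    exact lintegral_groundState_sq hex
  obtain ⟨E, hE, hEm, hH⟩ := hn hex K hK hKw
  calc ENNReal.ofReal (κ ^ (1 / 2 : ℝ) / 2) = ENNReal.ofReal κ ^ (1 / 2 : ℝ) / 2 := by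
        rw [ENNReal.ofReal_div_of_pos two_pos, ENNReal.ofReal_ofNat,
          ENNReal.ofReal_rpow_of_nonneg hκ.le (by norm_num)]
    _ ≤ labelAffinity L K Φ := labelAffinity_ge_of_blockEquidistribution hK hΦm hΦ1 _ hE hEm hH

/-- The warning as a kernel: UGS → LOC_h(η) → BEQ_h(η) → `BoseEinsteinCondensation` (no piece of the carving is
needed once the uniform block Harnack is available). [folklore] -/
theorem bec_of_blockEquidistribution₀ (η : ℝ≥0) (hU : BoxGroundStateUniqueness)
    (hloc : GroundStateHorizonCondensation η) (hbeq : GroundStateHorizonBlockEquidistribution η) :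
    _root_.BoseEinsteinCondensation :=
  bec_of_horizonAffinity₀ η hU hloc (horizonLabelAffinity_of_blockEquidistribution η hbeq)

/-- **FH_h(η)** (door for DEC_h · TAG STRONGER-or-equal than DEC_h (PROVED below) · MOTT-COMPATIBLE (holds with
`C = 1` in the number-locked model, where NUM_h fails: there the block propensity IS a function of the count
field) · UNDECIDED · input class = «the conditional block propensity of the tagged particle depends on the others
only through their horizon count field, up to a factor `C`») `GroundStateHorizonFibreHarnack η`: on a typical set
`G` of (count field, block) pairs (carrying half of `countAffinity`, as in DEC_h), for any two configurations
`Y, Y'` of the others with the SAME count field `m`, `q_B(Y)·P̂(Y') ≤ C·q_B(Y')·P̂(Y)` (cross-multiplied: no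
division, zeros allowed).  Why it might fail: the bound is a sup/inf over the WHOLE fibre — a caged or clustered
arrangement `Y` with typical counts could starve block `B` for the tagged particle (finite-`v` softens, hard cores
sharpen this); the typical set `G` only removes over-occupied fibres.
[cite: LSSY2005, Thm 7.1; GhoshPeres2017, DOI 10.1215/00127094-2017-0002] -/
@[conjecture] def GroundStateHorizonFibreHarnack (η : ℝ≥0) : Prop :=
  ∀ v : ℝ → ℝ≥0∞, IsRepulsiveFiniteRange v → 0 < scatteringLength v →
    ∃ M₀ : ℝ, 0 < M₀ ∧ ∀ M : ℝ, M₀ ≤ M → ∃ C : ℝ, 0 < C ∧ ∃ ρ₀ : ℝ, 0 < ρ₀ ∧ ∀ ρ : ℝ, 0 < ρ → ρ < ρ₀ →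
      ∀ᶠ n : ℕ in atTop,
        (∃ Ψ₀ : Config (n + 1) → ℝ, (∀ X, 0 ≤ Ψ₀ X) ∧
          IsGroundState v (sideLength ρ (n + 1)) (fun X => (Ψ₀ X : ℂ))) →
        ∀ K : ℕ, 0 < K → InWindow (M * ρ ^ (-(η : ℝ))) ρ (sideLength ρ (n + 1)) K →
          ∃ G : Set ((SubIdx K → ℕ) × SubIdx K),
            2 * (∑' m : SubIdx K → ℕ, ∑ B : SubIdx K,
                Gᶜ.indicator (countTerm (sideLength ρ (n + 1)) K
                  (groundState v (n + 1) (sideLength ρ (n + 1)))) (m, B)) ≤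
              countAffinity (sideLength ρ (n + 1)) K (groundState v (n + 1) (sideLength ρ (n + 1))) ∧
            ∀ (m : SubIdx K → ℕ) (B : SubIdx K), (m, B) ∈ G →
              ∀ Y Y' : Config n, countVec (sideLength ρ (n + 1) / (K : ℝ)) K Y = m →
                countVec (sideLength ρ (n + 1) / (K : ℝ)) K Y' = m →
                blockMass (sideLength ρ (n + 1)) K (groundState v (n + 1) (sideLength ρ (n + 1))) B Y *
                    sliceSq (groundState v (n + 1) (sideLength ρ (n + 1))) Y' ≤
                  ENNReal.ofReal C *
                    (blockMass (sideLength ρ (n + 1)) K (groundState v (n + 1) (sideLength ρ (n + 1))) B Y' *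
                      sliceSq (groundState v (n + 1) (sideLength ρ (n + 1))) Y)

/-- **FH_h ⟹ DEC_h** (`s₀ = C^{-1/4}`; reverse Cauchy–Schwarz on each typical fibre). [folklore] -/
theorem horizonCountDecoupling_of_fibreHarnack (η : ℝ≥0) (hfh : GroundStateHorizonFibreHarnack η) :
    GroundStateHorizonCountDecoupling η := by
  intro v hv ha
  obtain ⟨M₀, hM₀, h⟩ := hfh v hv ha
  refine ⟨M₀, hM₀, fun M hM => ?_⟩
  obtain ⟨C, hC, ρ₀, hρ₀, h'⟩ := h M hM
  refine ⟨(C ^ (1 / 4 : ℝ))⁻¹, inv_pos.2 (Real.rpow_pos_of_pos hC _), ρ₀, hρ₀, fun ρ hρ hρlt => ?_⟩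
  filter_upwards [h' ρ hρ hρlt] with n hn hex K hK hKw
  set L := sideLength ρ (n + 1) with hLdef
  set Φ := groundState v (n + 1) L with hΦdef
  have hΦm : Measurable Φ := measurable_groundState v (n + 1) L
  obtain ⟨G, hG, hH⟩ := hn hex K hK hKw
  refine ⟨G, hG, fun m B hp => ?_⟩
  have hF : MeasurableSet (countVec (n := n) (L / (K : ℝ)) K ⁻¹' {m}) :=
    measurable_countVec (L / (K : ℝ)) K (measurableSet_singleton m)
  have hCE : ENNReal.ofReal ((C ^ (1 / 4 : ℝ))⁻¹) = (ENNReal.ofReal C ^ (1 / 4 : ℝ))⁻¹ := by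
    rw [ENNReal.ofReal_inv_of_pos (Real.rpow_pos_of_pos hC _), ENNReal.ofReal_rpow_of_nonneg hC.le (by norm_num)]
  rw [hCE]
  unfold fibreSlice fibreMass
  exact setLIntegral_rpow_half_mul_ge_of_cross volume hF (measurable_sliceSq hΦm) (measurable_blockMass L K hΦm B)
    (by simpa using hC) ENNReal.ofReal_ne_top
    (fun Y hY Y' hY' => hH m B hp Y Y' hY hY')

/-- The kernel through the fibre-Harnack door:
UGS → LOC_h(η) → NUM_h(η) → FH_h(η) → `BoseEinsteinCondensation`. [folklore] -/
theorem bec_of_fibreHarnack₀ (η : ℝ≥0) (hU : BoxGroundStateUniqueness)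
    (hloc : GroundStateHorizonCondensation η) (hnum : GroundStateHorizonCountAffinity η)
    (hfh : GroundStateHorizonFibreHarnack η) : _root_.BoseEinsteinCondensation :=
  bec_of_countDecoupling₀ η hU hloc hnum (horizonCountDecoupling_of_fibreHarnack η hfh)

end Summit.AtomisticToContinuum.BoseEinsteinCondensation.Theorems.BoxCountShadow
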